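import Summits.CriticalPhenomena.PercolationContinuityZ3.Theorems.PercNearOneGluingNoHeavyLowerTailSBTens
import HarnessLib

/-!
# THEOREM B (Kozma–Nitzan goodness with a grandchild) — the 27 certificate conditions as scaled-Bernstein tensor checks
# (`NoHeavyLowerTail` cell, stmt-CriticalPhenomena-4575; prover `prim-hp-2`, gen 17)

Support file (`--supports stmt-CriticalPhenomena-4575`).  Computable definitions + soundness; no named facts, no sorries.
Memo: `run/shared/lean/prim/prim-hp-2/MEMO-gen15-grandchild-certificates.md` §3b–3d, §3k; `THEOREM-B-grandchild.md` §2;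
gen-17 notes `run/shared/lean/prim/prim-hp-2/MEMO-gen17-lean-certificates.md`.

SETTING (memo §3a).  Core `C` with relays `A = {1,2,3}` labelled by core reliability `s₁ ≤ s₂ ≤ s₃`; pendant stars `x, y, z` with hairs
`x_a, y_a, z_a ∈ [0,1]` and inner pairs `xy : t₃`, `xz : t₁`, `yz : t₂`; `K = C + x + y + z + pairs`, `B = {x,y}`, observer `o* = [xy]` of `K/B`
with the grandchild `z`.  THEOREM B: `Φ(K/B, o*; j) ≥ 0` for the `K`-loneliest relay `j`.  By memo §3b–3d it is equivalent to the existence,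
for every `(j, r)`, of a two-multiplier certificate in the five core scalars `(α,β,γ,δ,ε)`, and by Fourier–Motzkin to 27 polynomial
inequalities in the TWELVE side parameters (9 hairs, 3 pairs) on `[0,1]¹²`: nine BILINEAR ones `Φ_β·Q₁₂ + Φ_ε·Q_d ≥ 0` ((B1a),(B2a),(B3a) × r)
and eighteen TRILINEAR ones `X·v·w + Y·u·w ≤ G·u·v` ((B1b),(B2b),(B3b) × two branches × r; table `facX … facW` below = memo §3d / code
`trilin.coeffs`).  Every factor is the expectation of an INTEGER function of twelve independent Bernoulli bits (hair present / pair open):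
the target coefficients `Φ_v(j;r)` are expectations of the f-table value of the cell met by `o*` (or minus the pocket row) at a deterministic
configuration (`phiHat`), the world laws `Q_π` of `K`'s side are expectations of indicators (`qHat`).  Hence each slack is `SBTens.eval` of an
explicit tensor built by `ofFn`/`lift`/`mul`/`sub` (`slackBil`, `slackTri`), and `SBTens.eval_nonneg` reduces the inequality to ONE Boolean:
* `bil_of_check : checkBil j r = true → (∀ x ∈ [0,1]¹², 0 ≤ Φ_β Q₁₂ + Φ_ε Q_d)`,
* `tri_of_check : checkTri j r ad = true → (∀ x ∈ [0,1]¹², X v w + Y u w ≤ G u v)`.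
The nine bilinear checks are evaluated by `native_decide` in `…KNGoodGMgcCertBil*` (≈ 10⁷ leaf operations each).  The eighteen trilinear
checks (≈ 5·10⁹ leaf operations each — 4¹² coefficients of degree 3) exceed the gate's elaboration budget in the interpreter; they are the
SAME integers computed by kit job j105431 (`cert12.py`, numpy, exact int64) and by the two earlier independent implementations of the
(k,n₁,n₂)-group certificates (seat gen 15 `trilin3.py`; ttrl `hp2b/THMB-BERNSTEIN.md`), see the gen-17 memo for the three routes to discharge
them in-kernel (native compilation, Kronecker packing into GMP integers, degree-2 explicit-multiplier certificates).
Variable / bit indices: `0,1,2 = x₁,x₂,x₃`, `3,4,5 = y₁,y₂,y₃`, `6,7,8 = z₁,z₂,z₃`, `9 = t₂ (yz)`, `10 = t₁ (xz)`, `11 = t₃ (xy)`.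
Relay sets are bitmasks (`1 ↦ 1, 2 ↦ 2, 3 ↦ 4`); worlds of `{1,2,3}` are the bitmask of their unique nontrivial block (`0 = d, 3 = 12, 5 = 13,
6 = 23, 7 = 123`).  5-vectors are indexed `0..4 = (α,β,γ,δ,ε)`.
-/

namespace Summit.CriticalPhenomena.PercolationContinuityZ3.Theorems

namespace KNGoodGMgc

open SBTens

/-! ## Configuration semantics (integer functions of the twelve bits) -/

/-- A configuration of the twelve side bits. [folklore] -/
abbrev Cfg := ℕ → Bool

/-- Bitmask of a Boolean triple. [folklore] -/
def mask3 (b₁ b₂ b₃ : Bool) : ℕ := (bif b₁ then 1 else 0) + (bif b₂ then 2 else 0) + (bif b₃ then 4 else 0)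
/-- Relays hit by `x`. [folklore] -/
def hitX (c : Cfg) : ℕ := mask3 (c 0) (c 1) (c 2)
/-- Relays hit by `y`. [folklore] -/
def hitY (c : Cfg) : ℕ := mask3 (c 3) (c 4) (c 5)
/-- Relays hit by `z`. [folklore] -/
def hitZ (c : Cfg) : ℕ := mask3 (c 6) (c 7) (c 8)
/-- Relays hit by `o* = [xy]`. [folklore] -/
def hitO (c : Cfg) : ℕ := hitX c ||| hitY c
/-- Number of relays in a mask. [folklore] -/
def card3 (m : ℕ) : ℕ := (if m &&& 1 = 0 then 0 else 1) + (if m &&& 2 = 0 then 0 else 1) + (if m &&& 4 = 0 then 0 else 1)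
/-- The partition of `{1,2,3}` generated by a list of hit sets (each glues its members), as the mask of its nontrivial block
(`0` = discrete; with three relays any two nontrivial blocks meet, so the block is the union of the hit sets of size `≥ 2`). [folklore] -/
def worldOf (hs : List ℕ) : ℕ := (hs.filter fun m => 2 ≤ card3 m).foldl (· ||| ·) 0

/-- The f-table `Δf_j(σ,S)` of the memo (§3b; MEMO-gen12 §6): `P(o* b | cell) − P(j b | cell)` as a 5-vector in `(α,β,γ,δ,ε)`,
for the cell with side world `σ` and `o*`-block `S` (masks). [this work, memo §3b] -/
def ftab (j σ S : ℕ) : Fin 5 → ℤ :=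
  match j, σ, S with
  | 1, 0, 2 => ![1, 0, 0, 0, 0]
  | 1, 0, 4 => ![1, 1, 0, 0, 0]
  | 1, 3, 4 => ![0, 0, 0, 0, -1]
  | 1, 5, 2 => ![0, 0, -1, 0, 0]
  | 1, 6, 6 => ![0, 0, 0, 1, 0]
  | 2, 0, 1 => ![-1, 0, 0, 0, 0]
  | 2, 0, 4 => ![0, 1, 0, 0, 0]
  | 2, 3, 4 => ![0, 0, 0, 0, -1]
  | 2, 5, 5 => ![0, 0, 1, 0, 0]
  | 2, 6, 1 => ![0, 0, 0, -1, 0]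
  | 3, 0, 1 => ![-1, -1, 0, 0, 0]
  | 3, 0, 2 => ![0, -1, 0, 0, 0]
  | 3, 3, 3 => ![0, 0, 0, 0, 1]
  | 3, 5, 2 => ![0, 0, -1, 0, 0]
  | 3, 6, 1 => ![0, 0, 0, -1, 0]
  | _, _, _ => 0

/-- The row `P(a b) − P(c b)` of a core seen through a side whose world is `q` (mask), as a 5-vector:
`P(1)−P(2) = −Q_d α + Q₁₃ γ − Q₂₃ δ`, `P(1)−P(3) = −Q_d(α+β) + Q₁₂ ε − Q₂₃ δ`, `P(2)−P(3) = −Q_d β + Q₁₂ ε − Q₁₃ γ` (memo §3b). [this work] -/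
def rowvec (q a c : ℕ) : Fin 5 → ℤ :=
  let qd : ℤ := if q = 0 then 1 else 0
  let q12 : ℤ := if q = 3 then 1 else 0
  let q13 : ℤ := if q = 5 then 1 else 0
  let q23 : ℤ := if q = 6 then 1 else 0
  match a, c with
  | 1, 2 => ![-qd, 0, q13, -q23, 0]
  | 2, 1 => ![qd, 0, -q13, q23, 0]
  | 1, 3 => ![-qd, -qd, 0, -q23, q12]
  | 3, 1 => ![qd, qd, 0, q23, -q12]
  | 2, 3 => ![0, -qd, -q13, 0, q12]
  | 3, 2 => ![0, qd, q13, 0, -q12]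
  | _, _ => 0

/-- `D(j,1) = s_j − s₁` in `(α,β,γ,δ,ε)`-coordinates. [this work] -/
def dj1 (j : ℕ) : Fin 5 → ℤ :=
  match j with
  | 2 => ![1, 0, 0, 0, 0]
  | 3 => ![1, 1, 0, 0, 0]
  | _ => 0

/-- The target 5-vector `Φ(j;r)` of `K/B` at a DETERMINISTIC configuration (hairs and the two `z`-pairs; `t₃` is irrelevant): the f-table
value of the cell met by `o*`, or minus the pocket row (`{o*}`: residual `C+z`, reference `r`; `{o*,z}`: residual `C`, reference `1`).
Its expectation over independent bits is the memo's closed form `target5` (validated exactly, gen-17 `validate.py`). [this work] -/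
def phiHat (j r : ℕ) (c : Cfg) : Fin 5 → ℤ :=
  let Bo := hitO c
  let Bz := hitZ c
  if !(c 10) && !(c 9) then
    (if Bo = 0 then -rowvec (worldOf [Bz]) j r
     else ftab j (worldOf [Bo, Bz]) (if Bo &&& Bz = 0 then Bo else Bo ||| Bz))
  else
    (if Bo ||| Bz = 0 then -dj1 j else ftab j (worldOf [Bo ||| Bz]) (Bo ||| Bz))

/-- The world of `K`'s side `{x,y,z}` at a configuration: stars joined by open pairs are merged (with three stars, two open pairs already
connect everything). [this work] -/
def sideWorld (c : Cfg) : ℕ :=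
  let hx := hitX c
  let hy := hitY c
  let hz := hitZ c
  if (c 11 && c 10) || (c 11 && c 9) || (c 10 && c 9) then worldOf [hx ||| hy ||| hz]
  else if c 11 then worldOf [hx ||| hy, hz]
  else if c 10 then worldOf [hx ||| hz, hy]
  else if c 9 then worldOf [hx, hy ||| hz]
  else worldOf [hx, hy, hz]

/-- Indicator that the side world lies in the list `ws`. [this work] -/
def qHat (ws : List ℕ) (c : Cfg) : ℤ := if sideWorld c ∈ ws then 1 else 0

/-! ## The factors of the trilinear conditions `X v w + Y u w ≤ G u v` (memo §3d; branch `ad = false`: `Φ_δ / Q₂₃`, `ad = true`: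
`(Φ_α+Φ_δ) / (Q_d+Q₂₃)`) -/

/-- `X`: `j = 1`: `−Φ_γ`; `j = 2,3`: `−Φ_δ` resp. `−(Φ_α+Φ_δ)`. [this work] -/
def facX (j r : ℕ) (ad : Bool) (c : Cfg) : ℤ :=
  if j = 1 then -(phiHat j r c 2) else if ad then -(phiHat j r c 0 + phiHat j r c 3) else -(phiHat j r c 3)
/-- `u` (worlds under `X`): `j = 1`: `Q₁₃`; `j = 2,3`: `Q₂₃` resp. `Q_d + Q₂₃`. [this work] -/
def facU (j : ℕ) (ad : Bool) : List ℕ := if j = 1 then [5] else if ad then [0, 6] else [6]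
/-- `Y`: `j = 1,2`: `−Φ_ε`; `j = 3`: `−Φ_γ`. [this work] -/
def facY (j r : ℕ) (c : Cfg) : ℤ := if j = 3 then -(phiHat j r c 2) else -(phiHat j r c 4)
/-- `v` (worlds under `Y`): `j = 1,2`: `Q₁₂`; `j = 3`: `Q₁₃`. [this work] -/
def facV (j : ℕ) : List ℕ := if j = 3 then [5] else [3]
/-- `G`: `j = 1`: `Φ_δ` resp. `Φ_α+Φ_δ`; `j = 2`: `Φ_γ`; `j = 3`: `Φ_ε`. [this work] -/
def facG (j r : ℕ) (ad : Bool) (c : Cfg) : ℤ :=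
  if j = 1 then (if ad then phiHat j r c 0 + phiHat j r c 3 else phiHat j r c 3)
  else if j = 2 then phiHat j r c 2 else phiHat j r c 4
/-- `w` (worlds under `G`): `j = 1`: `Q₂₃` resp. `Q_d+Q₂₃`; `j = 2`: `Q₁₃`; `j = 3`: `Q₁₂`. [this work] -/
def facW (j : ℕ) (ad : Bool) : List ℕ := if j = 1 then (if ad then [0, 6] else [6]) else if j = 2 then [5] else [3]

/-! ## The slack tensors and the Boolean checks -/

/-- Slack tensor of the bilinear condition `Φ_β Q₁₂ + Φ_ε Q_d ≥ 0` (12 variables, degree 2). [this work] -/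
def slackBil (j r : ℕ) : Tens 12 :=
  add 12 (mul 12 (lift (ofFn 11 fun c => phiHat j r c 1)) (ofFn 12 (qHat [3])))
    (mul 12 (lift (ofFn 11 fun c => phiHat j r c 4)) (ofFn 12 (qHat [0])))

/-- Slack tensor `G u v − X v w − Y u w` of the trilinear condition (12 variables, degree 3). [this work] -/
def slackTri (j r : ℕ) (ad : Bool) : Tens 12 :=
  sub 12
    (sub 12 (mul 12 (lift (ofFn 11 (facG j r ad))) (mul 12 (ofFn 12 (qHat (facU j ad))) (ofFn 12 (qHat (facV j)))))
      (mul 12 (lift (ofFn 11 (facX j r ad))) (mul 12 (ofFn 12 (qHat (facV j))) (ofFn 12 (qHat (facW j ad))))))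
    (mul 12 (lift (ofFn 11 (facY j r))) (mul 12 (ofFn 12 (qHat (facU j ad))) (ofFn 12 (qHat (facW j ad)))))

/-- The bilinear certificate check: all scaled-Bernstein coefficients of the slack are `≥ 0`. [this work] -/
def checkBil (j r : ℕ) : Bool := allNonneg 12 (slackBil j r)
/-- The trilinear certificate check: all scaled-Bernstein coefficients of the slack are `≥ 0`. [this work] -/
def checkTri (j r : ℕ) (ad : Bool) : Bool := allNonneg 12 (slackTri j r ad)

/-! ## Real side: Bernoulli expectations and the soundness of the checks -/

/-- `bexp n f x = E[f(C)]` for independent bits `C_i ~ Bernoulli(x i)`, `i < n` (bits `≥ n` read `false`), realised as the evaluation of the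
vertex tensor `ofFn n f`; unfold with `bexp_zero` / `bexp_succ`. [folklore] -/
noncomputable def bexp (n : ℕ) (f : Cfg → ℤ) (x : ℕ → ℝ) : ℝ := eval n (ofFn n f) x

/-- `bexp` with no bits. [folklore] -/
theorem bexp_zero (f : Cfg → ℤ) (x : ℕ → ℝ) : bexp 0 f x = (f fun _ => false : ℝ) := eval_ofFn_zero f x
/-- `bexp`: conditioning on the last bit. [folklore] -/
theorem bexp_succ (n : ℕ) (f : Cfg → ℤ) (x : ℕ → ℝ) :
    bexp (n + 1) f x = (1 - x n) * bexp n (fun c => f (Function.update c n false)) x +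
      x n * bexp n (fun c => f (Function.update c n true)) x := eval_ofFn_succ n f x

section shapes
/-- Shape of a twelve-variable vertex tensor. [folklore] -/
theorem wf_q (f : Cfg → ℤ) : WF 12 (List.replicate 12 1) (ofFn 12 f) := WF_ofFn 12 f
/-- Shape of a lifted eleven-variable vertex tensor. [folklore] -/
theorem wf_p (f : Cfg → ℤ) : WF 12 (0 :: List.replicate 11 1) (lift (ofFn 11 f)) := WF_lift 11 _ _ (WF_ofFn 11 f)
/-- Product of two vertex tensors: shape and value. [folklore] -/
theorem qq_spec (f g : Cfg → ℤ) :
    WF 12 (List.replicate 12 2) (mul 12 (ofFn 12 f) (ofFn 12 g)) ∧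
      ∀ x, eval 12 (mul 12 (ofFn 12 f) (ofFn 12 g)) x = bexp 12 f x * bexp 12 g x := by
  have h := mul_spec 12 _ _ _ _ (by simp) (by simp) (wf_q f) (wf_q g)
  exact ⟨by simpa using h.1, h.2⟩
/-- Lifted tensor times a vertex tensor: shape and value. [folklore] -/
theorem pq_spec (f g : Cfg → ℤ) :
    WF 12 (1 :: List.replicate 11 2) (mul 12 (lift (ofFn 11 f)) (ofFn 12 g)) ∧
      ∀ x, eval 12 (mul 12 (lift (ofFn 11 f)) (ofFn 12 g)) x = bexp 11 f x * bexp 12 g x := by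
  have h := mul_spec 12 _ _ _ _ (by simp) (by simp) (wf_p f) (wf_q g)
  refine ⟨by simpa [List.replicate] using h.1, fun x => ?_⟩
  rw [h.2 x, eval_lift]; rfl
/-- Lifted tensor times a product of two vertex tensors: shape and value. [folklore] -/
theorem pqq_spec (f g h : Cfg → ℤ) :
    WF 12 (2 :: List.replicate 11 3) (mul 12 (lift (ofFn 11 f)) (mul 12 (ofFn 12 g) (ofFn 12 h))) ∧
      ∀ x, eval 12 (mul 12 (lift (ofFn 11 f)) (mul 12 (ofFn 12 g) (ofFn 12 h))) x = bexp 11 f x * (bexp 12 g x * bexp 12 h x) := by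
  obtain ⟨hw, he⟩ := qq_spec g h
  have hm := mul_spec 12 _ _ _ _ (by simp) (by simp) (wf_p f) hw
  refine ⟨by simpa [List.replicate] using hm.1, fun x => ?_⟩
  rw [hm.2 x, eval_lift, he x]; rfl
end shapes

/-- **Soundness of the bilinear check**: `checkBil j r` ⇒ `Φ_β(j;r)·Q₁₂ + Φ_ε(j;r)·Q_d ≥ 0` on `[0,1]¹²` ((B1a),(B2a),(B3a) of memo §3d,
multiplied out). [this work] -/
theorem bil_of_check (j r : ℕ) (h : checkBil j r = true) (x : ℕ → ℝ) (hx : ∀ i, 0 ≤ x i ∧ x i ≤ 1) :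
    0 ≤ bexp 11 (fun c => phiHat j r c 1) x * bexp 12 (qHat [3]) x + bexp 11 (fun c => phiHat j r c 4) x * bexp 12 (qHat [0]) x := by
  obtain ⟨w1, e1⟩ := pq_spec (fun c => phiHat j r c 1) (qHat [3])
  obtain ⟨w2, e2⟩ := pq_spec (fun c => phiHat j r c 4) (qHat [0])
  obtain ⟨-, e⟩ := add_spec 12 _ _ _ w1 w2
  have := eval_nonneg 12 (slackBil j r) x hx h
  rw [slackBil, e x, e1 x, e2 x] at this
  exact this

/-- **Soundness of the trilinear check**: `checkTri j r ad` ⇒ `X·v·w + Y·u·w ≤ G·u·v` on `[0,1]¹²` with the factors of memo §3d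
((B1b),(B2b),(B3b), branch `ad`). [this work] -/
theorem tri_of_check (j r : ℕ) (ad : Bool) (h : checkTri j r ad = true) (x : ℕ → ℝ) (hx : ∀ i, 0 ≤ x i ∧ x i ≤ 1) :
    bexp 11 (facX j r ad) x * (bexp 12 (qHat (facV j)) x * bexp 12 (qHat (facW j ad)) x) +
        bexp 11 (facY j r) x * (bexp 12 (qHat (facU j ad)) x * bexp 12 (qHat (facW j ad)) x) ≤
      bexp 11 (facG j r ad) x * (bexp 12 (qHat (facU j ad)) x * bexp 12 (qHat (facV j)) x) := by
  obtain ⟨w1, e1⟩ := pqq_spec (facG j r ad) (qHat (facU j ad)) (qHat (facV j))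
  obtain ⟨w2, e2⟩ := pqq_spec (facX j r ad) (qHat (facV j)) (qHat (facW j ad))
  obtain ⟨w3, e3⟩ := pqq_spec (facY j r) (qHat (facU j ad)) (qHat (facW j ad))
  obtain ⟨w12, e12⟩ := sub_spec 12 _ _ _ w1 w2
  obtain ⟨-, e⟩ := sub_spec 12 _ _ _ w12 w3
  have := eval_nonneg 12 (slackTri j r ad) x hx h
  rw [slackTri, e x, e12 x, e1 x, e2 x, e3 x] at this
  linarith

end KNGoodGMgc

end Summit.CriticalPhenomena.PercolationContinuityZ3.Theorems
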